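import Summits.CriticalPhenomena.Ising3DConformalLimit.Theses.OrthogonalFrameTP2
import Summits.CriticalPhenomena.Ising3DConformalLimit.Theorems.HyperoctahedralRPTwoPointLimitIsotropicHolds

/-!
# Crux `OrthogonalFrameTP2.LimitOrthantTP2` (stmt-CriticalPhenomena-17189) — birth skeleton `Lines/birth.lean`

Skeleton-registrar seat `planner-skel-stmt-CriticalPhenomena-17189-0`, 2026-08-17 (route re-audit bin HONEST-BET; BC3 of
`run/shared/lean/lens3/_common/BC.md`). Route `route-CriticalPhenomena-OrthogonalFrameTP2` (crux r7), sub-problem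
`Ising3DConformalLimit`. Line card: `Lines/birth.md`.

The crux (OLS)∞: for EVERY admissible limit `(ρ, Δ, S)` of `criticalCorr 3` (`ρ > 0` on `(0,1]`, `Δ > 0`, pointwise
scaling limit, non-degenerate, translation invariant, scale covariant) and every orthogonal continuum frame `x ≠ 0 ⊥ w`,
the kernel `(s, τ) ↦ K(s x + τ w)`, `K z = S 2 (0, z)`, is TP₂ on the quadrant: for `0 < s ≤ t`, `0 ≤ τ₁ ≤ τ₂`,
`K(t x + τ₁ w) K(s x + τ₂ w) ≤ K(s x + τ₁ w) K(t x + τ₂ w)`.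

FINDING THAT SHAPES THE CUT (tree state 2026-08-17, verified on the farm: `#print axioms` = propext / Classical.choice /
Quot.sound). Two-point ISOTROPY of every admissible limit is a LANDED THEOREM: item stmt-CriticalPhenomena-1984
`HyperoctahedralRP.TwoPointLimitIsotropic` was closed `proved` 2026-08-16T04:24Z by
`HyperoctahedralRPTwoPoint.twoPointLimitIsotropic_proof` (`= HRP2Rigidity_of ∘ twoPointKernelOfLimit_proof`; crux
stmt-1979 `HRP2Rigidity` closed `proved` 03:33Z, line `xray-mellin-transfer`, seven stubs landed), with the unguarded
corollary `kernel_rotation_invariant : … → S 2 ![0, R x] = S 2 ![0, x]` (hypotheses `hρ, hlim, hnd, htr, hsc` — a subset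
of the crux's). The crux docstring itself records "given positivity and homogeneity it is EQUIVALENT to invariance of K
under all linear isometries (⇐: K = c|y|^(−2Δ) has ∂ₛ∂τ log K = 4Δsτ/(s²+τ²)² ≥ 0)". Hence the crux is the `⇐` half
applied to a theorem: it is PROVABLE NOW, and the honest skeleton is the composition below whose only open obligations
are two S-sized pure-Mathlib lemmas. (The route's own lattice engine — rank-2 crux `CriticalOrthantTP2` (stmt-16804) and
the support `OrthantTP2LimitPassage : CriticalOrthantTP2 → LimitOrthantTP2` (stmt-17190) — stays an ALTERNATIVE line on
those items; it is not needed for this crux any more. Recommendation to the re-audit: re-bin stmt-17189 from HONEST-BET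
to PROVABLE-NOW and hand it to one prover / two stub-workers.)

The cut (two statements, neither the crux reworded; BC3 probes below — every stub → crux and stub →
`Ising3DConformalLimit` probe FAILS):

* S1 `stub_radialProfile` (provable now, S; pure Mathlib) — a `(-2Δ)`-homogeneous kernel `K : ℝ³ → ℝ` invariant under
  every linear isometry off `0` is `C‖x‖^(-2Δ)` off `0` (`C = K e₀`; two unit vectors are exchanged by the reflection in
  `(ℝ ∙ (u - e₀))ᗮ`, `Submodule.reflection_sub`). No positivity, no continuity, no sign of `Δ`.
* S2 `stub_powerKernelFrameTP2` (provable now, S; pure Mathlib) — for `Δ > 0` the power kernel `‖·‖^(-2Δ)` satisfies the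
  quadrant TP₂ minor in every orthogonal frame: Pythagoras `‖a x + b w‖² = a²‖x‖² + b²‖w‖²` and
  `(t²X + τ₁²W)(s²X + τ₂²W) − (s²X + τ₁²W)(t²X + τ₂²W) = XW(t² − s²)(τ₂² − τ₁²) ≥ 0`, then antitonicity of `r ↦ r^(-Δ)`.

Composition `LimitOrthantTP2_of : S1 → S2 → OrthogonalFrameTP2.LimitOrthantTP2` is kernel-checked below with NO sorry,
concluding the route decl BY NAME; inside it: homogeneity of `K` from `IsScaleCovariant` (`kernel_homogeneous`, the
computation of `closes` rev 5), invariance of `K` from the imported `kernel_rotation_invariant`, the four frame points off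
`0` (`frame_point_ne_zero`, `s, t > 0`), S1 ⇒ `K = C‖·‖^(-2Δ)` at those points, S2 × `C·C ≥ 0`. Its hypotheses are the
registered stubs BY NAME through the implementation-detail aliases `__Registered.stub_…` (device of the sibling skeletons
`Cruxes/ProxyUniversality/Lines/birth.lean`, `Cruxes/TwoPointRegularVariation/Lines/birth.lean`); the closing
`example : LimitOrthantTP2 := LimitOrthantTP2_of stub_radialProfile stub_powerKernelFrameTP2` instantiates it with the two
sorried stubs literally, as an `example` so that no sorry-tainted constant of the crux's type enters the environment.

Checks (farm, 2026-08-17): `lean check --json` rc 0, errors [], sorries 2 = the two `stub_*` (warning lines = the two stub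
declarations; zero elsewhere — `kernel_homogeneous`, `frame_point_ne_zero`, `LimitOrthantTP2_of` are closed).
BC3 probes (planner folder `bc/probe_<stub>_{crux,summit}.lean`, importing ONLY the route file; stub signature inlined;
`set_option maxHeartbeats 400000`; probe A `first | exact? | simpa | aesop` on `stub → T`, probe B `intro h; first | exact? |
simpa [T] using h | aesop`): S1 → LimitOrthantTP2 FAIL/FAIL (rc 1, unsolved goals, aesop exhaustive search failed, 57 s);
S1 → Ising3DConformalLimit FAIL/FAIL (28 s); S2 → LimitOrthantTP2 FAIL/FAIL (60 s); S2 → Ising3DConformalLimit FAIL/FAIL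
(29 s). No stub is cheaply the crux or the summit: S1 and S2 are statements about abstract / explicit kernels on `ℝ³`
that do not mention `S`, and the crux follows from them only through the landed isotropy theorem.

Disproof used: none — `Cruxes/LimitOrthantTP2/` had no `Disproof.lean` and no workfiles at registration (`ledger crux ls
stmt-CriticalPhenomena-17189`: "(no workfiles yet)"); the item's evidence is two grounder notes (2026-08-16: NEW / open,
"equivalent to two-point isotropy") — superseded by the landing of stmt-1984 earlier that day; `ledger negatives --problem
CriticalPhenomena` (11 entries: Cardy / SAW / percolation) has no statement about Ising scaling limits or these kernels.
-/

namespace Summit.CriticalPhenomena.Ising3DConformalLimit.Cruxes.LimitOrthantTP2.Birth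

open scoped BigOperators Topology Classical InnerProductSpace
open Filter Set Function
open Literature.Probability.LatticeModels
open Summit.CriticalPhenomena.Ising3DConformalLimit.Theses.OrthogonalFrameTP2 (LimitOrthantTP2)

/-! ## Registered stubs (two statements; `LimitOrthantTP2_of` takes exactly these, by name) -/

/-- **S1 `stub_radialProfile` — a `(-2Δ)`-homogeneous kernel on `ℝ³` invariant under every linear isometry is a
power law `C‖x‖^(-2Δ)` off the origin** (pure Mathlib, provable now, size S): `x = ‖x‖ • u` with `‖u‖ = 1`,
homogeneity gives `K x = ‖x‖^(-2Δ) K u`, and `K u = K e₀` for a fixed unit vector `e₀` because two unit vectors are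
exchanged by a linear isometry (the reflection in `(ℝ ∙ (u - e₀))ᗮ`, `Submodule.reflection_sub`); `C := K e₀`.
No sign condition on `Δ` and no positivity of `K` is needed. [Schoenberg1951; folklore] -/
theorem stub_radialProfile :
    ∀ (Δ : ℝ) (K : EuclideanSpace ℝ (Fin 3) → ℝ),
      (∀ c : ℝ, 0 < c → ∀ x, K (c • x) = c ^ (-(2 * Δ)) * K x) →
      (∀ (R : EuclideanSpace ℝ (Fin 3) ≃ₗᵢ[ℝ] EuclideanSpace ℝ (Fin 3)) (x : EuclideanSpace ℝ (Fin 3)),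
        x ≠ 0 → K (R x) = K x) →
      ∃ C : ℝ, ∀ x : EuclideanSpace ℝ (Fin 3), x ≠ 0 → K x = C * ‖x‖ ^ (-(2 * Δ)) := by
  sorry

/-- **S2 `stub_powerKernelFrameTP2` — the power kernel `y ↦ ‖y‖^(-2Δ)` (`Δ > 0`) is TP₂ on the quadrant of every
orthogonal frame** (pure Mathlib, provable now, size S): for `x ≠ 0 ⊥ w`, `0 < s ≤ t`, `0 ≤ τ₁ ≤ τ₂`,
`‖t x + τ₁ w‖^(-2Δ) ‖s x + τ₂ w‖^(-2Δ) ≤ ‖s x + τ₁ w‖^(-2Δ) ‖t x + τ₂ w‖^(-2Δ)`. Pythagoras gives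
`‖a x + b w‖² = a²X + b²W` (`X = ‖x‖² > 0`, `W = ‖w‖²`), and
`(t²X + τ₁²W)(s²X + τ₂²W) - (s²X + τ₁²W)(t²X + τ₂²W) = XW(t² - s²)(τ₂² - τ₁²) ≥ 0`; raise to the power `-Δ < 0`
(`Real.rpow` is antitone in the base for negative exponents; all four bases are `> 0` since `s > 0`). This is the `⇐`
half of the equivalence "frame-wise TP₂ ⟺ isotropy" recorded in the crux docstring
(`∂ₛ∂_τ log ‖s x + τ w‖^(-2Δ) = 4Δ s τ X W/(s²X + τ²W)² ≥ 0`). [Karlin1968 (TP₂ of Pólya-type kernels); folklore] -/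
theorem stub_powerKernelFrameTP2 :
    ∀ (Δ : ℝ), 0 < Δ → ∀ x w : EuclideanSpace ℝ (Fin 3), x ≠ 0 → ⟪x, w⟫_ℝ = 0 →
      ∀ s t τ₁ τ₂ : ℝ, 0 < s → s ≤ t → 0 ≤ τ₁ → τ₁ ≤ τ₂ →
        ‖t • x + τ₁ • w‖ ^ (-(2 * Δ)) * ‖s • x + τ₂ • w‖ ^ (-(2 * Δ)) ≤
          ‖s • x + τ₁ • w‖ ^ (-(2 * Δ)) * ‖t • x + τ₂ • w‖ ^ (-(2 * Δ)) := by
  sorry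

/-! ### The two stub statements BY NAME — the hypotheses of `LimitOrthantTP2_of`

`#h21_check_skeleton` (run by `ledger skeleton check`) admits a hypothesis of the composing theorem only if its head
constant is a registered obligation or is NAMED like a declared stub; so each registered stub `stub_X : <signature> :=
by sorry` above is mirrored by `abbrev __Registered.stub_X : Prop := <the same signature, verbatim>` and
`LimitOrthantTP2_of` is stated over the two aliases (device of the sibling birth skeletons, e.g.
`Cruxes/ProxyUniversality/Lines/birth.lean`). Each alias is an `abbrev`, definitionally its statement; the `example`
after the composition instantiates it with the registered stubs (kernel-checked), so no pre-composed sorry-tainted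
witness of the crux enters the environment. -/
namespace __Registered

/-- Alias of the statement of the registered stub `stub_radialProfile` (S1), keyed by its name. -/
abbrev stub_radialProfile : Prop :=
    ∀ (Δ : ℝ) (K : EuclideanSpace ℝ (Fin 3) → ℝ),
      (∀ c : ℝ, 0 < c → ∀ x, K (c • x) = c ^ (-(2 * Δ)) * K x) →
      (∀ (R : EuclideanSpace ℝ (Fin 3) ≃ₗᵢ[ℝ] EuclideanSpace ℝ (Fin 3)) (x : EuclideanSpace ℝ (Fin 3)),
        x ≠ 0 → K (R x) = K x) →
      ∃ C : ℝ, ∀ x : EuclideanSpace ℝ (Fin 3), x ≠ 0 → K x = C * ‖x‖ ^ (-(2 * Δ))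

/-- Alias of the statement of the registered stub `stub_powerKernelFrameTP2` (S2), keyed by its name. -/
abbrev stub_powerKernelFrameTP2 : Prop :=
    ∀ (Δ : ℝ), 0 < Δ → ∀ x w : EuclideanSpace ℝ (Fin 3), x ≠ 0 → ⟪x, w⟫_ℝ = 0 →
      ∀ s t τ₁ τ₂ : ℝ, 0 < s → s ≤ t → 0 ≤ τ₁ → τ₁ ≤ τ₂ →
        ‖t • x + τ₁ • w‖ ^ (-(2 * Δ)) * ‖s • x + τ₂ • w‖ ^ (-(2 * Δ)) ≤
          ‖s • x + τ₁ • w‖ ^ (-(2 * Δ)) * ‖t • x + τ₂ • w‖ ^ (-(2 * Δ))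

end __Registered

/-! ## Glue (proved): homogeneity of the limit kernel and non-vanishing of the frame points -/

/-- Scale covariance of `S` at `n = 2` read on the kernel `z ↦ S 2 (0, z)`: homogeneity of degree `-2Δ`
(the computation of `closes`, rev 5). -/
theorem kernel_homogeneous {Δ : ℝ} {S : CorrFamily 3} (hsc : IsScaleCovariant Δ S) :
    ∀ c : ℝ, 0 < c → ∀ z : EuclideanSpace ℝ (Fin 3), S 2 ![0, c • z] = c ^ (-(2 * Δ)) * S 2 ![0, z] := by
  intro c hc z
  have h := hsc 2 c hc ![0, z]
  have hcfg : (fun i => c • (![0, z] : Fin 2 → EuclideanSpace ℝ (Fin 3)) i) = ![0, c • z] := by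
    funext i; fin_cases i <;> simp
  rw [hcfg] at h
  rw [h]; norm_num

/-- In an orthogonal frame `x ≠ 0 ⊥ w` every point `a x + b w` with `a ≠ 0` is off the origin (pair it with `x`). -/
theorem frame_point_ne_zero {x w : EuclideanSpace ℝ (Fin 3)} (hx : x ≠ 0) (hxw : ⟪x, w⟫_ℝ = 0)
    {a : ℝ} (ha : a ≠ 0) (b : ℝ) : a • x + b • w ≠ 0 := by
  intro h0
  have h1 : ⟪x, a • x + b • w⟫_ℝ = 0 := by rw [h0, inner_zero_right]
  rw [inner_add_right, real_inner_smul_right, real_inner_smul_right, hxw, mul_zero, add_zero,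
    real_inner_self_eq_norm_sq] at h1
  have h2 : ‖x‖ ^ 2 = 0 := (mul_eq_zero.1 h1).resolve_left ha
  exact hx (norm_eq_zero.1 (pow_eq_zero_iff two_ne_zero |>.1 h2))

/-! ## Composition (sorry-free): the two stub STATEMENTS imply the crux, by name -/

/-- **COMPOSITION.** S1 → S2 → `OrthogonalFrameTP2.LimitOrthantTP2` (item stmt-CriticalPhenomena-17189, concluded BY
NAME). Given an admissible limit `(ρ, Δ, S)` and a frame `x ≠ 0 ⊥ w`: the kernel `K z := S 2 (0, z)` is homogeneous of
degree `-2Δ` (`kernel_homogeneous`, from `IsScaleCovariant`) and invariant under every linear isometry by the LANDED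
tree theorem `HyperoctahedralRPTwoPoint.kernel_rotation_invariant` (two-point isotropy of every admissible critical `ℤ³`
Ising scaling limit = item stmt-CriticalPhenomena-1984 `HyperoctahedralRP.TwoPointLimitIsotropic`, closed `proved`
2026-08-16 by `twoPointLimitIsotropic_proof` = `HRP2Rigidity_of ∘ twoPointKernelOfLimit_proof`, axioms
propext/Classical.choice/Quot.sound); S1 then gives `K z = C ‖z‖^(-2Δ)` off `0`; the four frame points are off `0`
(`frame_point_ne_zero`, `s, t > 0`); S2 is the required minor for the power kernel, and multiplying it by `C·C ≥ 0`
gives the minor for `K`. -/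
theorem LimitOrthantTP2_of :
    __Registered.stub_radialProfile → __Registered.stub_powerKernelFrameTP2 →
      Summit.CriticalPhenomena.Ising3DConformalLimit.Theses.OrthogonalFrameTP2.LimitOrthantTP2 := by
  intro h1 h2
  dsimp only [__Registered.stub_radialProfile, __Registered.stub_powerKernelFrameTP2] at h1 h2
  intro ρ Δ S hρ hΔ hl hnd htr hsc x w hx hxw s t τ₁ τ₂ hs hst hτ₁ hτ₁₂
  have hhom := kernel_homogeneous (S := S) hsc
  have hinv : ∀ (R : EuclideanSpace ℝ (Fin 3) ≃ₗᵢ[ℝ] EuclideanSpace ℝ (Fin 3)) (z : EuclideanSpace ℝ (Fin 3)),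
      z ≠ 0 → (fun q : EuclideanSpace ℝ (Fin 3) => S 2 ![0, q]) (R z) = (fun q => S 2 ![0, q]) z :=
    fun R z _ =>
      Summit.CriticalPhenomena.Ising3DConformalLimit.HyperoctahedralRPTwoPoint.kernel_rotation_invariant
        hρ hl hnd htr hsc R z
  obtain ⟨C, hC⟩ := h1 Δ (fun q => S 2 ![0, q]) hhom hinv
  have ht : 0 < t := lt_of_lt_of_le hs hst
  have hxw' : ⟪x, w⟫_ℝ = 0 := hxw
  rw [hC _ (frame_point_ne_zero hx hxw' ht.ne' τ₁), hC _ (frame_point_ne_zero hx hxw' hs.ne' τ₂),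
    hC _ (frame_point_ne_zero hx hxw' hs.ne' τ₁), hC _ (frame_point_ne_zero hx hxw' ht.ne' τ₂)]
  have key := h2 Δ hΔ x w hx hxw' s t τ₁ τ₂ hs hst hτ₁ hτ₁₂
  have hCC : 0 ≤ C * C := mul_self_nonneg C
  calc C * ‖t • x + τ₁ • w‖ ^ (-(2 * Δ)) * (C * ‖s • x + τ₂ • w‖ ^ (-(2 * Δ)))
        = ‖t • x + τ₁ • w‖ ^ (-(2 * Δ)) * ‖s • x + τ₂ • w‖ ^ (-(2 * Δ)) * (C * C) := by ring
    _ ≤ ‖s • x + τ₁ • w‖ ^ (-(2 * Δ)) * ‖t • x + τ₂ • w‖ ^ (-(2 * Δ)) * (C * C) :=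
        mul_le_mul_of_nonneg_right key hCC
    _ = C * ‖s • x + τ₁ • w‖ ^ (-(2 * Δ)) * (C * ‖t • x + τ₂ • w‖ ^ (-(2 * Δ))) := by ring

/-- The registered stubs discharge the hypotheses of `LimitOrthantTP2_of` verbatim (an `example`, so no pre-composed
witness of the crux enters the environment; its only `sorry`s are the stubs'). -/
example : LimitOrthantTP2 := LimitOrthantTP2_of stub_radialProfile stub_powerKernelFrameTP2

end Summit.CriticalPhenomena.Ising3DConformalLimit.Cruxes.LimitOrthantTP2.Birth
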